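import Mathlib
import HarnessLib
import Literature.Geometry.DiscreteGeometry.BondGraph
import Literature.Geometry.DiscreteGeometry.KissingPatterns
import Literature.Algebra.EuclideanLattices.FccBccLattices
import Summits.AtomisticToContinuum.Crystallization.Theorems.PricedLinkCensusSoftLayerPropagationStubMetricDet
import Summits.AtomisticToContinuum.Crystallization.Theorems.PricedLinkCensusSoftLayerPropagationStubMetricSolve

/-!
# Small-cluster rigidity III: the near-regular octahedron
# (crux `SoftLayerPropagation`, line `Sketch`, stub `stub_metric`, registered sub-goal `metric_octahedron`)

Route `PricedLinkCensus`, crux `SoftLayerPropagation` (stmt-AtomisticToContinuum-14233), line `Sketch`.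

**The octahedron lemma.**  Six points of `ℝ³` grouped in three "diagonal" pairs `(a, c)`, `(b, d)`,
`(x, z)`; the twelve EDGES are the pairs of points from different diagonals.  If every squared edge
lies in `[1, 1 + α]` (`0 ≤ α ≤ 1/10`) and the three squared diagonals are `≥ 1` (in the bond setting:
bonds of a contact octahedron at tolerance `η`, and the non-bonds across it), then

* the three diagonals have a common centre up to `O(α)`:
  `‖(a + c) − (b + d)‖², ‖(b + d) − (x + z)‖², ‖(x + z) − (a + c)‖² ≤ 21 α²/2`
  — in particular the far apex of the octahedron over the square `(a, b, c, d)` seen from `x` is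
  `z = a + c − x + O(3.25 α)` (the "apex prediction" used by the no-merge / ordered-caps arguments;
  `0.13` edge lengths at `α = 0.0404`);
* the squared diagonals lie in `[2 − 2α − 21α²/2, 2 + 4α + 6α²]` (regular value `2`): at the bond
  tolerance `α = 0.0404` (`η = 1/100`, two-sided window `[1, 1.0201²]`) a square diagonal is
  `≥ 1.379` and `≤ 1.473` edge lengths;
* the diagonals are pairwise orthogonal up to `α`: `|⟪a − c, b − d⟫|, |⟪b − d, x − z⟫|, |⟪x − z, a − c⟫| ≤ α`.

Proof ("three diagonals"): with `nᵢ` the diagonal vectors and `mᵢ` the sums of their endpoints, the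
four edges joining diagonals `i` and `j` are `(Δᵢⱼ ± nᵢ ∓ nⱼ)/2` with `Δᵢⱼ = mᵢ − mⱼ`; polarisation of
the four squared lengths gives `|⟪Δᵢⱼ, nᵢ⟫|, |⟪Δᵢⱼ, nⱼ⟫|, |⟪nᵢ, nⱼ⟫| ≤ α` and
`‖Δᵢⱼ‖² + ‖nᵢ‖² + ‖nⱼ‖² ∈ [4, 4 + 4α]`; since `Δ₁₂ + Δ₂₃ + Δ₃₁ = 0` also `|⟪Δᵢⱼ, nₖ⟫| ≤ 2α` for the
third index; so each `Δᵢⱼ` has small inner products with the nearly orthogonal triple `n₁, n₂, n₃` of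
vectors of length `≥ 1`, and `metric_solve` gives `‖Δᵢⱼ‖² (1 − 3α² − 2α³) ≤ 16 α²`; a second pass
with the improved length floor `‖nₖ‖ ≥ 5/4` gives `21α²/2`.  All `[folklore]`.
-/

noncomputable section

namespace Summit.AtomisticToContinuum.Crystallization.Theorems

open Literature.Geometry.DiscreteGeometry

/-- Polarisation bookkeeping for two "diagonals" `(p, q)` and `(r, s)` of `ℝ³`: with `Δ = (p+q) − (r+s)`,
`n = p − q`, `n' = r − s`, the four squared edge lengths `‖p−r‖², ‖p−s‖², ‖q−r‖², ‖q−s‖²` determine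
`⟪Δ, n⟫`, `⟪Δ, n'⟫`, `⟪n, n'⟫` and `‖Δ‖² + ‖n‖² + ‖n'‖²`. [folklore] -/
theorem diag_pair_identities (p q r s : EuclideanSpace ℝ (Fin 3)) :
    inner ℝ (p + q - (r + s)) (p - q) = (‖p - r‖ ^ 2 + ‖p - s‖ ^ 2 - ‖q - r‖ ^ 2 - ‖q - s‖ ^ 2) / 2 ∧
    inner ℝ (p + q - (r + s)) (r - s) = (‖p - s‖ ^ 2 + ‖q - s‖ ^ 2 - ‖p - r‖ ^ 2 - ‖q - r‖ ^ 2) / 2 ∧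
    inner ℝ (p - q) (r - s) = (‖p - s‖ ^ 2 + ‖q - r‖ ^ 2 - ‖p - r‖ ^ 2 - ‖q - s‖ ^ 2) / 2 ∧
    ‖p + q - (r + s)‖ ^ 2 + ‖p - q‖ ^ 2 + ‖r - s‖ ^ 2 =
      ‖p - r‖ ^ 2 + ‖p - s‖ ^ 2 + ‖q - r‖ ^ 2 + ‖q - s‖ ^ 2 := by
  simp only [Literature.Algebra.EuclideanLattices.inner_fin_three,
    Literature.Algebra.EuclideanLattices.norm_sq_fin_three, PiLp.add_apply, PiLp.sub_apply]
  refine ⟨by ring, by ring, by ring, by ring⟩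

/-- The cyclic relation `Δ₁₂ + Δ₂₃ + Δ₃₁ = 0` between the centre offsets, in inner-product form:
`⟪(p+q)−(r+s), w⟫ = −⟪(r+s)−(u+v), w⟫ − ⟪(u+v)−(p+q), w⟫`. [folklore] -/
theorem diag_offsets_inner (p q r s u v w : EuclideanSpace ℝ (Fin 3)) :
    inner ℝ (p + q - (r + s)) w = -inner ℝ (r + s - (u + v)) w - inner ℝ (u + v - (p + q)) w := by
  have : p + q - (r + s) = -(r + s - (u + v)) - (u + v - (p + q)) := by abel
  rw [this, inner_sub_left, inner_neg_left]

/-- Numerics of the first solving pass (`ν = 1`, `γ = α`, `Σβ = 4α`):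
`D (1 − 3α² − 2α³) ≤ 16α²` gives `D ≤ 17 α²` for `α ≤ 1/10`. [folklore] -/
theorem octa_pass_one {D α : ℝ} (hα : 0 ≤ α) (hα' : α ≤ 1 / 10) (hD : 0 ≤ D)
    (h : D * (1 ^ 6 - 3 * α ^ 2 * 1 ^ 2 - 2 * α ^ 3) ≤ 16 * α ^ 2) : D ≤ 17 * α ^ 2 := by
  have hden : (968 : ℝ) / 1000 ≤ 1 ^ 6 - 3 * α ^ 2 * 1 ^ 2 - 2 * α ^ 3 := by
    nlinarith [mul_nonneg hα hα, mul_nonneg (mul_nonneg hα hα) hα]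
  nlinarith [mul_le_mul_of_nonneg_left hden hD]

/-- Numerics of the second solving pass (`ν = 5/4`, `γ = α`, `Σβ = 4α`):
`D ((5/4)⁶ − 3α²(5/4)² − 2α³) ≤ 16α² (5/4)⁴` gives `D ≤ 21α²/2` for `α ≤ 1/10`. [folklore] -/
theorem octa_pass_two {D α : ℝ} (hα : 0 ≤ α) (hα' : α ≤ 1 / 10) (hD : 0 ≤ D)
    (h : D * ((5 / 4) ^ 6 - 3 * α ^ 2 * (5 / 4) ^ 2 - 2 * α ^ 3) ≤ 16 * α ^ 2 * (5 / 4) ^ 4) :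
    D ≤ 21 / 2 * α ^ 2 := by
  have hden : (376 : ℝ) / 100 ≤ (5 / 4) ^ 6 - 3 * α ^ 2 * (5 / 4) ^ 2 - 2 * α ^ 3 := by
    nlinarith [mul_nonneg hα hα, mul_nonneg (mul_nonneg hα hα) hα]
  nlinarith [mul_le_mul_of_nonneg_left hden hD]

set_option maxHeartbeats 800000 in
/-- **Registered sub-goal `metric_octahedron`: rigidity of the near-regular octahedron with explicit
constants.**  Diagonal pairs `(a,c)`, `(b,d)`, `(x,z)`; twelve squared edges in `[1, 1+α]`,
`0 ≤ α ≤ 1/10`, three squared diagonals `≥ 1`.  Then the centres of the diagonals agree to `21α²/2`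
(squared), the squared diagonals lie in `[2 − 2α − 21α²/2, 2 + 4α + 6α²]`, and the diagonals are
orthogonal to within `α`. [folklore] -/
theorem metric_octahedron : ∀ α : ℝ, 0 ≤ α → α ≤ 1 / 10 →
    ∀ (a c b d x z : EuclideanSpace ℝ (Fin 3)),
      1 ≤ ‖a - b‖ ^ 2 → ‖a - b‖ ^ 2 ≤ 1 + α → 1 ≤ ‖a - d‖ ^ 2 → ‖a - d‖ ^ 2 ≤ 1 + α →
      1 ≤ ‖c - b‖ ^ 2 → ‖c - b‖ ^ 2 ≤ 1 + α → 1 ≤ ‖c - d‖ ^ 2 → ‖c - d‖ ^ 2 ≤ 1 + α →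
      1 ≤ ‖b - x‖ ^ 2 → ‖b - x‖ ^ 2 ≤ 1 + α → 1 ≤ ‖b - z‖ ^ 2 → ‖b - z‖ ^ 2 ≤ 1 + α →
      1 ≤ ‖d - x‖ ^ 2 → ‖d - x‖ ^ 2 ≤ 1 + α → 1 ≤ ‖d - z‖ ^ 2 → ‖d - z‖ ^ 2 ≤ 1 + α →
      1 ≤ ‖x - a‖ ^ 2 → ‖x - a‖ ^ 2 ≤ 1 + α → 1 ≤ ‖x - c‖ ^ 2 → ‖x - c‖ ^ 2 ≤ 1 + α →
      1 ≤ ‖z - a‖ ^ 2 → ‖z - a‖ ^ 2 ≤ 1 + α → 1 ≤ ‖z - c‖ ^ 2 → ‖z - c‖ ^ 2 ≤ 1 + α →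
      1 ≤ ‖a - c‖ ^ 2 → 1 ≤ ‖b - d‖ ^ 2 → 1 ≤ ‖x - z‖ ^ 2 →
      ‖a + c - (b + d)‖ ^ 2 ≤ 21 / 2 * α ^ 2 ∧ ‖b + d - (x + z)‖ ^ 2 ≤ 21 / 2 * α ^ 2 ∧
        ‖x + z - (a + c)‖ ^ 2 ≤ 21 / 2 * α ^ 2 ∧
      (2 - 2 * α - 21 / 2 * α ^ 2 ≤ ‖a - c‖ ^ 2 ∧ ‖a - c‖ ^ 2 ≤ 2 + 4 * α + 6 * α ^ 2) ∧
      (2 - 2 * α - 21 / 2 * α ^ 2 ≤ ‖b - d‖ ^ 2 ∧ ‖b - d‖ ^ 2 ≤ 2 + 4 * α + 6 * α ^ 2) ∧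
      (2 - 2 * α - 21 / 2 * α ^ 2 ≤ ‖x - z‖ ^ 2 ∧ ‖x - z‖ ^ 2 ≤ 2 + 4 * α + 6 * α ^ 2) ∧
      |inner ℝ (a - c) (b - d)| ≤ α ∧ |inner ℝ (b - d) (x - z)| ≤ α ∧ |inner ℝ (x - z) (a - c)| ≤ α := by
  intro α hα hα' a c b d x z hab hab' had had' hcb hcb' hcd hcd' hbx hbx' hbz hbz' hdx hdx' hdz hdz'
    hxa hxa' hxc hxc' hza hza' hzc hzc' hac hbd hxz
  -- the three diagonal pairs: identities, and the cyclic relation for the third inner products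
  obtain ⟨i12a, i12b, i12c, i12d⟩ := diag_pair_identities a c b d
  obtain ⟨i23a, i23b, i23c, i23d⟩ := diag_pair_identities b d x z
  obtain ⟨i31a, i31b, i31c, i31d⟩ := diag_pair_identities x z a c
  have c12 := diag_offsets_inner a c b d x z (x - z)
  have c23 := diag_offsets_inner b d x z a c (a - c)
  have c31 := diag_offsets_inner x z a c b d (b - d)
  have e31 : inner ℝ (x - z) (a - c) = inner ℝ (a - c) (x - z) := real_inner_comm _ _
  -- names (made opaque)
  generalize hn₁ : a - c = n₁ at *
  generalize hn₂ : b - d = n₂ at *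
  generalize hn₃ : x - z = n₃ at *
  generalize hΔ₁₂ : a + c - (b + d) = Δ₁₂ at *
  generalize hΔ₂₃ : b + d - (x + z) = Δ₂₃ at *
  generalize hΔ₃₁ : x + z - (a + c) = Δ₃₁ at *
  -- the nine small inner products read off the edges
  have o12 : |inner ℝ n₁ n₂| ≤ α :=
    abs_le.2 ⟨by linarith only [i12c, had, hcb, hab', hcd'], by linarith only [i12c, had', hcb', hab, hcd]⟩
  have o23 : |inner ℝ n₂ n₃| ≤ α :=
    abs_le.2 ⟨by linarith only [i23c, hbz, hdx, hbx', hdz'], by linarith only [i23c, hbz', hdx', hbx, hdz]⟩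
  have o31 : |inner ℝ n₃ n₁| ≤ α :=
    abs_le.2 ⟨by linarith only [i31c, hxc, hza, hxa', hzc'], by linarith only [i31c, hxc', hza', hxa, hzc]⟩
  have o13 : |inner ℝ n₁ n₃| ≤ α := by rwa [e31] at o31
  have p12a : |inner ℝ Δ₁₂ n₁| ≤ α :=
    abs_le.2 ⟨by linarith only [i12a, hab, had, hcb', hcd'], by linarith only [i12a, hab', had', hcb, hcd]⟩
  have p12b : |inner ℝ Δ₁₂ n₂| ≤ α :=
    abs_le.2 ⟨by linarith only [i12b, had, hcd, hab', hcb'], by linarith only [i12b, had', hcd', hab, hcb]⟩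
  have p23a : |inner ℝ Δ₂₃ n₂| ≤ α :=
    abs_le.2 ⟨by linarith only [i23a, hbx, hbz, hdx', hdz'], by linarith only [i23a, hbx', hbz', hdx, hdz]⟩
  have p23b : |inner ℝ Δ₂₃ n₃| ≤ α :=
    abs_le.2 ⟨by linarith only [i23b, hbz, hdz, hbx', hdx'], by linarith only [i23b, hbz', hdz', hbx, hdx]⟩
  have p31a : |inner ℝ Δ₃₁ n₃| ≤ α :=
    abs_le.2 ⟨by linarith only [i31a, hxa, hxc, hza', hzc'], by linarith only [i31a, hxa', hxc', hza, hzc]⟩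
  have p31b : |inner ℝ Δ₃₁ n₁| ≤ α :=
    abs_le.2 ⟨by linarith only [i31b, hxc, hzc, hxa', hza'], by linarith only [i31b, hxc', hzc', hxa, hza]⟩
  -- the third inner products
  have p12c : |inner ℝ Δ₁₂ n₃| ≤ 2 * α := by
    have h1 := abs_le.1 p23b; have h2 := abs_le.1 p31a
    rw [c12]; exact abs_le.2 ⟨by linarith only [h1, h2], by linarith only [h1, h2]⟩
  have p23c : |inner ℝ Δ₂₃ n₁| ≤ 2 * α := by
    have h1 := abs_le.1 p12a; have h2 := abs_le.1 p31b
    rw [c23]; exact abs_le.2 ⟨by linarith only [h1, h2], by linarith only [h1, h2]⟩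
  have p31c : |inner ℝ Δ₃₁ n₂| ≤ 2 * α := by
    have h1 := abs_le.1 p12b; have h2 := abs_le.1 p23a
    rw [c31]; exact abs_le.2 ⟨by linarith only [h1, h2], by linarith only [h1, h2]⟩
  -- the diagonals have length `≥ 1`
  have l₁ : 1 ≤ ‖n₁‖ := (pow_le_pow_iff_left₀ zero_le_one (norm_nonneg _) two_ne_zero).1 (by simpa using hac)
  have l₂ : 1 ≤ ‖n₂‖ := (pow_le_pow_iff_left₀ zero_le_one (norm_nonneg _) two_ne_zero).1 (by simpa using hbd)
  have l₃ : 1 ≤ ‖n₃‖ := (pow_le_pow_iff_left₀ zero_le_one (norm_nonneg _) two_ne_zero).1 (by simpa using hxz)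
  -- first pass: solve for the three offsets with `ν = 1`
  have hα2' : 0 ≤ 2 * α := by linarith only [hα]
  have s12 := metric_solve 1 α α α (2 * α) one_pos hα hα hα hα2' Δ₁₂ n₁ n₂ n₃ l₁ l₂ l₃ o12 o13 o23
    p12a p12b p12c
  have s23 := metric_solve 1 α (2 * α) α α one_pos hα hα2' hα hα Δ₂₃ n₁ n₂ n₃ l₁ l₂ l₃ o12 o13 o23
    p23c p23a p23b
  have s31 := metric_solve 1 α α (2 * α) α one_pos hα hα hα2' hα Δ₃₁ n₁ n₂ n₃ l₁ l₂ l₃ o12 o13 o23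
    p31b p31c p31a
  have hΔ0₁ : 0 ≤ ‖Δ₁₂‖ ^ 2 := sq_nonneg _
  have hΔ0₂ : 0 ≤ ‖Δ₂₃‖ ^ 2 := sq_nonneg _
  have hΔ0₃ : 0 ≤ ‖Δ₃₁‖ ^ 2 := sq_nonneg _
  have D12 : ‖Δ₁₂‖ ^ 2 ≤ 17 * α ^ 2 := octa_pass_one hα hα' hΔ0₁
    (s12.trans_eq (by ring : (α + α + 2 * α) ^ 2 * (1 : ℝ) ^ 4 = 16 * α ^ 2))
  have D23 : ‖Δ₂₃‖ ^ 2 ≤ 17 * α ^ 2 := octa_pass_one hα hα' hΔ0₂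
    (s23.trans_eq (by ring : (2 * α + α + α) ^ 2 * (1 : ℝ) ^ 4 = 16 * α ^ 2))
  have D31 : ‖Δ₃₁‖ ^ 2 ≤ 17 * α ^ 2 := octa_pass_one hα hα' hΔ0₃
    (s31.trans_eq (by ring : (α + 2 * α + α) ^ 2 * (1 : ℝ) ^ 4 = 16 * α ^ 2))
  -- second pass: now `‖nₖ‖² ≥ 2 − 2α − 17α² ≥ (5/4)²`
  have hαα : α ^ 2 ≤ 1 / 10 * α := by
    rw [sq]; exact mul_le_mul_of_nonneg_right hα' hα
  have hα2 : 0 ≤ α ^ 2 := sq_nonneg α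
  have q₁ : (5 / 4 : ℝ) ^ 2 ≤ ‖n₁‖ ^ 2 := by
    linarith only [i12d, i31d, i23d, D12, D31, hΔ0₂, hab, had, hcb, hcd, hxa, hxc, hza, hzc, hbx', hbz', hdx',
      hdz', hαα, hα']
  have q₂ : (5 / 4 : ℝ) ^ 2 ≤ ‖n₂‖ ^ 2 := by
    linarith only [i12d, i23d, i31d, D12, D23, hΔ0₃, hab, had, hcb, hcd, hbx, hbz, hdx, hdz, hxa', hxc', hza',
      hzc', hαα, hα']
  have q₃ : (5 / 4 : ℝ) ^ 2 ≤ ‖n₃‖ ^ 2 := by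
    linarith only [i23d, i31d, i12d, D23, D31, hΔ0₁, hbx, hbz, hdx, hdz, hxa, hxc, hza, hzc, hab', had', hcb',
      hcd', hαα, hα']
  have h54 : (0 : ℝ) ≤ 5 / 4 := by norm_num
  have l₁' : (5 : ℝ) / 4 ≤ ‖n₁‖ := (pow_le_pow_iff_left₀ h54 (norm_nonneg _) two_ne_zero).1 q₁
  have l₂' : (5 : ℝ) / 4 ≤ ‖n₂‖ := (pow_le_pow_iff_left₀ h54 (norm_nonneg _) two_ne_zero).1 q₂
  have l₃' : (5 : ℝ) / 4 ≤ ‖n₃‖ := (pow_le_pow_iff_left₀ h54 (norm_nonneg _) two_ne_zero).1 q₃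
  have h54p : (0 : ℝ) < 5 / 4 := by norm_num
  have t12 := metric_solve (5 / 4) α α α (2 * α) h54p hα hα hα hα2' Δ₁₂ n₁ n₂ n₃ l₁' l₂' l₃' o12 o13 o23
    p12a p12b p12c
  have t23 := metric_solve (5 / 4) α (2 * α) α α h54p hα hα2' hα hα Δ₂₃ n₁ n₂ n₃ l₁' l₂' l₃' o12 o13 o23
    p23c p23a p23b
  have t31 := metric_solve (5 / 4) α α (2 * α) α h54p hα hα hα2' hα Δ₃₁ n₁ n₂ n₃ l₁' l₂' l₃' o12 o13 o23
    p31b p31c p31a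
  have E12 : ‖Δ₁₂‖ ^ 2 ≤ 21 / 2 * α ^ 2 := octa_pass_two hα hα' hΔ0₁
    (t12.trans_eq (by ring : (α + α + 2 * α) ^ 2 * ((5 : ℝ) / 4) ^ 4 = 16 * α ^ 2 * (5 / 4) ^ 4))
  have E23 : ‖Δ₂₃‖ ^ 2 ≤ 21 / 2 * α ^ 2 := octa_pass_two hα hα' hΔ0₂
    (t23.trans_eq (by ring : (2 * α + α + α) ^ 2 * ((5 : ℝ) / 4) ^ 4 = 16 * α ^ 2 * (5 / 4) ^ 4))
  have E31 : ‖Δ₃₁‖ ^ 2 ≤ 21 / 2 * α ^ 2 := octa_pass_two hα hα' hΔ0₃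
    (t31.trans_eq (by ring : (α + 2 * α + α) ^ 2 * ((5 : ℝ) / 4) ^ 4 = 16 * α ^ 2 * (5 / 4) ^ 4))
  -- the diagonals: `‖nᵢ‖² + ‖nⱼ‖² = Sᵢⱼ − ‖Δᵢⱼ‖² ∈ [4 − 21α²/2, 4 + 4α]`
  refine ⟨E12, E23, E31, ⟨?_, ?_⟩, ⟨?_, ?_⟩, ⟨?_, ?_⟩, o12, o23, o31⟩
  · linarith only [i12d, i31d, i23d, E12, E31, hΔ0₂, hab, had, hcb, hcd, hxa, hxc, hza, hzc, hbx', hbz', hdx',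
      hdz']
  · linarith only [i12d, i31d, i23d, E23, hΔ0₁, hΔ0₃, hab', had', hcb', hcd', hxa', hxc', hza', hzc', hbx, hbz,
      hdx, hdz, hα2]
  · linarith only [i12d, i23d, i31d, E12, E23, hΔ0₃, hab, had, hcb, hcd, hbx, hbz, hdx, hdz, hxa', hxc', hza',
      hzc']
  · linarith only [i12d, i23d, i31d, E31, hΔ0₁, hΔ0₂, hab', had', hcb', hcd', hbx', hbz', hdx', hdz', hxa, hxc,
      hza, hzc, hα2]
  · linarith only [i23d, i31d, i12d, E23, E31, hΔ0₁, hbx, hbz, hdx, hdz, hxa, hxc, hza, hzc, hab', had', hcb',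
      hcd']
  · linarith only [i23d, i31d, i12d, E12, hΔ0₂, hΔ0₃, hbx', hbz', hdx', hdz', hxa', hxc', hza', hzc', hab, had,
      hcb, hcd, hα2]

/-- **Corollary: the apex prediction.**  In the situation of `metric_octahedron`, the far apex `z` of
the octahedron over the square `(a, b, c, d)` with near apex `x` satisfies
`‖z − (a + c − x)‖² ≤ 21 α²/2` (and likewise with `b + d` in place of `a + c`). [folklore] -/
theorem metric_octahedron_apex {α : ℝ} (hα : 0 ≤ α) (hα' : α ≤ 1 / 10)
    (a c b d x z : EuclideanSpace ℝ (Fin 3))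
    (hab : 1 ≤ ‖a - b‖ ^ 2) (hab' : ‖a - b‖ ^ 2 ≤ 1 + α) (had : 1 ≤ ‖a - d‖ ^ 2) (had' : ‖a - d‖ ^ 2 ≤ 1 + α)
    (hcb : 1 ≤ ‖c - b‖ ^ 2) (hcb' : ‖c - b‖ ^ 2 ≤ 1 + α) (hcd : 1 ≤ ‖c - d‖ ^ 2) (hcd' : ‖c - d‖ ^ 2 ≤ 1 + α)
    (hbx : 1 ≤ ‖b - x‖ ^ 2) (hbx' : ‖b - x‖ ^ 2 ≤ 1 + α) (hbz : 1 ≤ ‖b - z‖ ^ 2) (hbz' : ‖b - z‖ ^ 2 ≤ 1 + α)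
    (hdx : 1 ≤ ‖d - x‖ ^ 2) (hdx' : ‖d - x‖ ^ 2 ≤ 1 + α) (hdz : 1 ≤ ‖d - z‖ ^ 2) (hdz' : ‖d - z‖ ^ 2 ≤ 1 + α)
    (hxa : 1 ≤ ‖x - a‖ ^ 2) (hxa' : ‖x - a‖ ^ 2 ≤ 1 + α) (hxc : 1 ≤ ‖x - c‖ ^ 2) (hxc' : ‖x - c‖ ^ 2 ≤ 1 + α)
    (hza : 1 ≤ ‖z - a‖ ^ 2) (hza' : ‖z - a‖ ^ 2 ≤ 1 + α) (hzc : 1 ≤ ‖z - c‖ ^ 2) (hzc' : ‖z - c‖ ^ 2 ≤ 1 + α)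
    (hac : 1 ≤ ‖a - c‖ ^ 2) (hbd : 1 ≤ ‖b - d‖ ^ 2) (hxz : 1 ≤ ‖x - z‖ ^ 2) :
    ‖z - (a + c - x)‖ ^ 2 ≤ 21 / 2 * α ^ 2 ∧ ‖z - (b + d - x)‖ ^ 2 ≤ 21 / 2 * α ^ 2 := by
  obtain ⟨-, h23, h31, -⟩ := metric_octahedron α hα hα' a c b d x z hab hab' had had' hcb hcb' hcd hcd'
    hbx hbx' hbz hbz' hdx hdx' hdz hdz' hxa hxa' hxc hxc' hza hza' hzc hzc' hac hbd hxz
  constructor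
  · have : z - (a + c - x) = x + z - (a + c) := by abel
    rw [this]; exact h31
  · have : z - (b + d - x) = -(b + d - (x + z)) := by abel
    rw [this, norm_neg]; exact h23

end Summit.AtomisticToContinuum.Crystallization.Theorems

end
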